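import Summits.ValiantsHypothesis.ValiantsHypothesis.Theorems.SymPencilPerFourInnerRankTenFamily

/-!
# Route `SymPencil` — inner rank of the `2 | 2` row split of `per_4`: the mixed type I of the
# `a`-slot kernel is impossible (`--supports` stmt-ValiantsHypothesis-5674 `SdcSuperquadratic`;
# (8,8) column of the size tables, isotropic-kernel route, memo `NOTE-p6g15-5674-IR12-reduction.md` §2)

For a joint family `Σ_r c_r t_r((a,b),(y₂,y₃))² = per (a; b; y₂; y₃)` (any number of squares, any
weights) and pairwise distinct column indices `p, q, c, d`:

* `false_of_zero_pair`: it is impossible that both `t_r((e_p,0),(e_c,0)) = 0` and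
  `t_r((e_p,0),(0,e_d)) = 0` for all `r` — the polarised identity at `(e_p, e_q; e_c, e_d)` reads
  `2 Σ_r c_r n_{qc} n'_{qd} = 1` after the two vanishing `a`-parts are removed, while the same
  identity at `(0, e_q; e_c, e_d)` reads `2 Σ_r c_r n_{qc} n'_{qd} = 0`;
* `false_of_mixedI`: hence the "mixed type I" shape of the `a`-slot kernel
  (`(a_c e_c + a_d e_d, 0) ∈ K_a` and `(0, a_c e_c - a_d e_d) ∈ K_a` for all `a`, i.e.
  `t_r((a,0),(a_c e_c + a_d e_d, 0)) = 0 = t_r((a,0),(0, a_c e_c - a_d e_d))`) is impossible: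
  evaluating at `a = e_c`, `a = e_d` and `a = e_p + e_c`, `a = e_p + e_d` extracts exactly the two
  vanishing vectors of `false_of_zero_pair`.

Honest framing: one case of a CONDITIONAL reduction of the cells `(8,8,10)`, `(8,8,11)`; the cells
stay open; the window `27 ≤ sdc(per_4) ≤ 29`, the crux and `VP ≠ VNP` are untouched.  No
definitions, no named facts. [folklore]
-/

noncomputable section

-- single-conjunct layout: Sub = Summit, duplicated namespace component intended
set_option linter.dupNamespace false

namespace Summit.ValiantsHypothesis.ValiantsHypothesis.Theorems.SymPencilPerFourInnerRankMixedKill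

open Matrix Finset Module
open Summit.ValiantsHypothesis.ValiantsHypothesis.Theorems.SymPencilPerFourInnerRankRows
open Summit.ValiantsHypothesis.ValiantsHypothesis.Theorems.SymPencilPerFourInnerRankTenFamily

variable {K : Type*} [Field K] {ι : Type*} [Fintype ι]

/-- The permanent of a permutation matrix given by rows `e_p, e_q, e_i, e_d` (pairwise distinct)
is `1`. [folklore] -/
theorem per_single_distinct (p q i d : Fin 4) (hpq : p ≠ q) (hpi : p ≠ i) (hpd : p ≠ d)
    (hqi : q ≠ i) (hqd : q ≠ d) (hid : i ≠ d) :
    (Matrix.of ![(Pi.single p (1 : K)), Pi.single q 1, Pi.single i 1, Pi.single d 1]).permanent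
      = 1 := by
  rw [permanent_of_rows]
  fin_cases p <;> fin_cases q <;> simp (config := {decide := true}) at hpq ⊢ <;>
    fin_cases i <;> simp (config := {decide := true}) at hpi hqi ⊢ <;>
    fin_cases d <;> simp (config := {decide := true}) at hpd hqd hid ⊢

/-- **Two vanishing `a`-slot vectors with a common row index are impossible.**  For pairwise
distinct `p, q, c, d`: not both `t_r((e_p,0),(e_c,0)) = 0 ∀ r` and `t_r((e_p,0),(0,e_d)) = 0 ∀ r`.
[folklore] -/
theorem false_of_zero_pair [CharZero K] (c : ι → K)
    (t : ι → (((Fin 4 → K) × (Fin 4 → K)) →ₗ[K] ((Fin 4 → K) × (Fin 4 → K)) →ₗ[K] K))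
    (hJ : ∀ a b y₂ y₃ : Fin 4 → K,
      ∑ r, c r * (t r (a, b) (y₂, y₃)) ^ 2 = (Matrix.of ![a, b, y₂, y₃]).permanent)
    (p q i d : Fin 4) (hpq : p ≠ q) (hpi : p ≠ i) (hpd : p ≠ d) (hqi : q ≠ i) (hqd : q ≠ d)
    (hid : i ≠ d)
    (h1 : ∀ r, t r (Pi.single p 1, 0) (Pi.single i 1, 0) = 0)
    (h2 : ∀ r, t r (Pi.single p 1, 0) (0, Pi.single d 1) = 0) : False := by
  have hsplit : ∀ (y : (Fin 4 → K) × (Fin 4 → K)) r,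
      t r (Pi.single p 1, Pi.single q 1) y = t r (Pi.single p 1, 0) y + t r (0, Pi.single q 1) y :=
    fun y r => by
      rw [← LinearMap.add_apply, ← map_add]; simp
  -- the polarised identity at `(e_p, e_q; e_i, e_d)` and at `(0, e_q; e_i, e_d)`
  have hA := polar c t hJ (Pi.single p 1) (Pi.single q 1) (Pi.single i 1) 0 0 (Pi.single d 1)
  have hB := polar c t hJ 0 (Pi.single q 1) (Pi.single i 1) 0 0 (Pi.single d 1)
  rw [per_zero_row₂, add_zero, per_single_distinct p q i d hpq hpi hpd hqi hqd hid] at hA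
  rw [per_zero_row₀, per_zero_row₀, add_zero] at hB
  simp_rw [hsplit, h1, h2, zero_add] at hA
  rw [hB] at hA
  exact zero_ne_one hA

/-- **Mixed type I of the `a`-slot kernel is impossible.**  If for all `a ∈ K⁴` both
`(a_i e_i + a_d e_d, 0)` and `(0, a_i e_i - a_d e_d)` lie in the kernel of `y ↦ (t_r((a,0),y))_r`
(the shape of a "mixed type I" kernel, up to the torus scaling), the joint identity is
contradictory.  (`p, q` are the two remaining indices.) [folklore] -/
theorem false_of_mixedI [CharZero K] (c : ι → K)
    (t : ι → (((Fin 4 → K) × (Fin 4 → K)) →ₗ[K] ((Fin 4 → K) × (Fin 4 → K)) →ₗ[K] K))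
    (hJ : ∀ a b y₂ y₃ : Fin 4 → K,
      ∑ r, c r * (t r (a, b) (y₂, y₃)) ^ 2 = (Matrix.of ![a, b, y₂, y₃]).permanent)
    (p q i d : Fin 4) (hpq : p ≠ q) (hpi : p ≠ i) (hpd : p ≠ d) (hqi : q ≠ i) (hqd : q ≠ d)
    (hid : i ≠ d)
    (hI₂ : ∀ (a : Fin 4 → K) r,
      t r (a, 0) (a i • Pi.single i 1 + a d • Pi.single d 1, 0) = 0)
    (hI₃ : ∀ (a : Fin 4 → K) r,
      t r (a, 0) (0, a i • Pi.single i 1 - a d • Pi.single d 1) = 0) : False := by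
  refine false_of_zero_pair c t hJ p q i d hpq hpi hpd hqi hqd hid (fun r => ?_) (fun r => ?_)
  · -- from `hI₂` at `a = e_i` and `a = e_p + e_i`
    have h1 := hI₂ (Pi.single i 1) r
    have h2 := hI₂ (Pi.single p 1 + Pi.single i 1) r
    simp only [Pi.single_apply, if_pos, Pi.add_apply] at h1 h2
    simp only [if_neg hid.symm, if_neg hpi.symm, if_neg hpd.symm, zero_smul, add_zero,
      one_smul, zero_add] at h1 h2
    rw [show (((Pi.single p 1 + Pi.single i 1 : Fin 4 → K)), (0 : Fin 4 → K)) =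
      ((Pi.single p 1, 0) : (Fin 4 → K) × (Fin 4 → K)) + (Pi.single i 1, 0) by simp, map_add,
      LinearMap.add_apply, h1, add_zero] at h2
    exact h2
  · have h1 := hI₃ (Pi.single d 1) r
    have h2 := hI₃ (Pi.single p 1 + Pi.single d 1) r
    simp only [Pi.single_apply, if_pos, Pi.add_apply] at h1 h2
    simp only [if_neg hid, if_neg hpi.symm, if_neg hpd.symm, zero_smul, zero_sub,
      one_smul, zero_add] at h1 h2
    rw [show (((Pi.single p 1 + Pi.single d 1 : Fin 4 → K)), (0 : Fin 4 → K)) =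
      ((Pi.single p 1, 0) : (Fin 4 → K) × (Fin 4 → K)) + (Pi.single d 1, 0) by simp, map_add,
      LinearMap.add_apply, h1, add_zero] at h2
    -- `h2 : t r (e_p, 0) (0, -e_d) = 0`
    have h3 : t r (Pi.single p 1, 0) (0, Pi.single d 1) =
        -(t r (Pi.single p 1, 0) (0, -Pi.single d 1)) := by
      rw [← map_neg]; simp
    rw [h3, h2, neg_zero]

end Summit.ValiantsHypothesis.ValiantsHypothesis.Theorems.SymPencilPerFourInnerRankMixedKill

end
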